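import Literature.AlgebraicGeometry.Hyperkaehler.KummerTypeIntermediateJacobian
import Literature.AlgebraicGeometry.Hyperkaehler.GeneralizedKummerTypeHodgeConjecture
import Literature.AlgebraicGeometry.HodgeTheory.DominatedByPowersHodgeConjecture
import Literature.AlgebraicGeometry.Motives.AbelianVarietyProductDimProofs
import HarnessLib

/-!
# Varieties of `Kum²`- and `Kum³`-type are cohomologically dominated by the powers of a discriminant-1 Weil abelian fourfold; the Hodge conjecture for all their powers (Floccari–Fu 2026, *The hyper-Kummer construction*, Thm. 13.2 (ii)(iii) = Thm. K (ii), Cor. 13.4 — PREPRINT) — NAMED FACT + kernel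

Layer `Literature/AlgebraicGeometry/Hyperkaehler`.  Cross-ladder literature-typing layer D-0088(4), tranche
LT-H4 (recent-theorem / open-question harvest), seat `hodge-lit-oqh-2` (gen 5): the PRINTED ANSWER, for
`n = 2, 3`, to the question Floccari–Varesco (Math. Ann. 2024/25) leave open in their Rem. 2.2 — the Hodge
conjecture for the POWERS of a projective variety of `Kumⁿ`-type — and the `n = 2, 3` instance ("S-case") of
the motivic mechanism the `Kum⁴` cell of LADDER-HodgeAV rung H3 uses as a CONDITIONAL node
(`Summit.Ventures.HodgeKum4.GammaInvariantsDominatedKum4` ∕ `exists_isDominatedByPowers_kum4Type`: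
"dominated by the powers of an abelian fourfold all of whose powers satisfy HC").  HONEST FRAMING: typed
≠ proved ≠ endorsed; the source is a PREPRINT (arXiv, July 2026), graded PREPRINT on every declaration that
depends on it; nothing here asserts `HodgeConjecture`, `HC_AV`, `W₆`, `HC_Kum4Type`, or anything for
`Kumⁿ`, `n ≥ 4` (the source: "No statement" there).

## Source of record (read at source; locators = materialised arXiv text `paper:arxiv-2607.07528`)

S. Floccari, L. Fu, *The hyper-Kummer construction*, arXiv:2607.07528 (July 2026), 112 pp.
[`FloccariFu2026HyperKummer`; PREPRINT — not refereed; NB the bib key `FloccariFu2026` is their J. Math.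
Pures Appl. 210 (2026) paper on OG6 double covers, a different text].

* §13, **Conjecture 13.1** (= Conj. 1.4 of the introduction) [p0085:L42–p0086:L1], verbatim: "Let `X` be a
  projective hyper-Kähler variety, and let `KS(X)` be the associated Kuga–Satake abelian variety. Then `X`
  is motivated by `KS(X)`, i.e., the motive of `X` belongs to the thick tensor subcategory of motives
  generated by the motive of `KS(X)`."  [p0086:L7–L9]: "In the sequel, `Mot` is the category of rational
  homological motives with respect to singular cohomology, and `h` is the contravariant functor sending a
  smooth projective variety to its homological motive."
* **Theorem 13.2** ([Flo24, FV24, Flo23, FF26]) [p0086:L14–L24], verbatim: "Consider the following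
  hyper-Kähler varieties: (i) any K3 surface or `K3^[n]`-type variety satisfying the following condition:
  there exists an isometric embedding of rational quadratic spaces `H²_tr(X,ℚ) ↪ U_ℚ^{⊕3} ⊕ ⟨-a⟩_ℚ`, for
  some positive integer `a`. (ii) any variety of `Kum²`-type; (iii) any variety of `Kum³`-type; (iv) any
  OG6-resolution.  Then the Kuga–Satake variety `KS(X)` of `X` is isogenous to a power of an abelian
  fourfold of Weil type with discriminant `1`, and Conjecture 13.1 holds for the homological motive of `X`,
  that is, `h(X)` belongs to the thick tensor subcategory of homological motives generated by the motive of
  `KS(X)`."  Proof of (ii) [p0086:L29–p0087:L9]: "Let `K` be any variety of `Kumⁿ`-type and let `A` be its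
  intermediate Jacobian. By [O'G21, Mar22, Voi22], `A` is an abelian fourfold of Weil type with
  discriminant `1`, the Kuga–Satake variety of `K` is isogenous to `A⁴`, and the Kuga–Satake–Hodge
  conjecture holds for `K`. Moreover, there exists an algebraic cycle `γ` inducing the canonical isomorphism
  of Hodge structures between `H¹(A,ℚ)` and `H³(K,ℚ)`. Assume now that `K` is of `Kum²`-type. The standard
  conjectures hold for `K` by [Fos24]. […] By [HT13], we have `h⁺(K) = a₂(K) ⊕ ℚ^{⊕80}(-2)` in `Mot`, and
  therefore `h⁺(K)` belongs to `⟨h(KS(K))⟩`. Finally, also `h⁻(K)` lies in `⟨h(KS(K))⟩`, being the image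
  of the cup-product map `a₂(K) ⊗ h³(K) → h(K)` […]."  Proof of (iii) [p0087:L10–L37]: "For a variety of
  `Kum³`-type, the conclusion is a corollary of the results from [Flo23], which crucially relies on the
  hyper-Kummer construction. […] By [Flo23, Proof of Theorem 1.1], there is a decomposition
  `h(K) = h(K)^G ⊕ h⁻(K) ⊕ ℚ^{⊕240}(-3)` (13.1) […] `h(K)^G` is a direct summand of the motive `h(Y_K)` of
  the hyper-Kummer variety […] it lies in `⟨h(KS(K))⟩` by (i). […] Therefore, by the decomposition (13.1),
  we conclude that `h(K)` belongs to the subcategory `⟨h(KS(K))⟩` of homological motives."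
* §13.1 **Corollary 13.4** [p0088:L9–L12], verbatim: "Let `X₁, ⋯, X_n` be any collection of hyper-Kähler
  varieties as in Theorem 13.2 such that the `X_i` are Hodge similar to each other. Then the Hodge
  conjecture holds for all products of powers of `X₁, ⋯, X_n` as well as of their Kuga–Satake varieties.
  In particular, the Hodge conjecture holds for all powers of any hyper-Kähler variety `X` as in Theorem
  13.2."  Its proof [p0088:L13–L26]: "each of the Kuga–Satake varieties `KS(X_i)` is isogenous to some
  power of the same abelian fourfold `A`, which is of Weil type with discriminant `1`. Therefore, the tensor
  subcategories `⟨h(KS(X_i))⟩` of `Mot` all coincide with `⟨h(A)⟩`. The Hodge conjecture has been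
  established for any abelian fourfold of Weil type with discriminant `1` [Mar22] and all its powers [Flo26]
  (see also [FF26] for an alternative proof); equivalently, the Hodge realization functor `R : ⟨h(A)⟩ → HS_ℚ`
  is full. […] Theorem 13.2 implies that `h(Y) ∈ ⟨h(A)⟩`. Hence […] the Hodge conjecture holds for (all
  powers of) `Y`."
* Introduction, **Theorem K** (= Thm. 13.2, Cors. 13.4 and 13.10) [p0013:L35–p0014:L9]: "(ii) any variety of
  `Kum²` or `Kum³`-type; […] Moreover, the Hodge conjecture and the Tate conjecture hold for `X` and any of
  its powers.  The second statement follows from the first one, since the Hodge and Tate conjectures hold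
  for powers of any abelian fourfold of Weil type with discriminant `1` as is proven in [Flo26]".  Bib note
  of `FloccariFu2026HyperKummer`: "No statement for `Kumⁿ`, `n ≥ 4`".
* The question this answers, as printed: S. Floccari, M. Varesco, Math. Ann. 391 (2025) [`FloccariVaresco2024`;
  REFEREED], Rem. 2.2 [paper:arxiv-2308.04865 p0005:L17–L18]: "the Hodge conjecture holds for `X` and all of
  its powers if and only if the restriction of `R` to `⟨𝔥(X)⟩_Mot` is full" (for `Kumⁿ` OPEN in that text
  beyond the subalgebra generated by `H²`, Rem. 4.4).
* The inputs the tree already holds BY NAME (cited, not restated): O'Grady 2021 Thm. 1.5 ∧ Markman 2023 ∧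
  Voisin 2022 = `Hyperkaehler.Markman2023_thirdCohomology_kummerType_discOneWeilFourfold` (the intermediate
  Jacobian `A = J³(X)` as a discriminant-1 Weil fourfold with `γ : H¹(A) ≅ H³(X)` algebraic; file
  `KummerTypeIntermediateJacobian`, whose Weil-type binder block this file copies symbol for symbol);
  "HC for all powers of a discriminant-1 Weil fourfold" =
  `HodgeTheory.FloccariFu2026_hodgeClasses_algebraic_powers_discOneWeilFourfold` (REFEREED; file
  `HodgeTheory/WeilFourfoldsDiscOnePowers`); Arapura 2006 Lemma 4.2 =
  `HodgeTheory.Arapura2006_hodgeClasses_algebraic_of_isDominatedByPowers` (REFEREED; file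
  `HodgeTheory/DominatedByPowersHodgeConjecture`); the single-variety Hodge statements
  `Hyperkaehler.FloccariVaresco2024_hodgeClasses_algebraic_kum2Type` (FV24 Cor. 1.2, REFEREED) and
  `Hyperkaehler.Floccari2023_hodgeClasses_algebraic_kum3Type` (Floccari 2023 Thm. 1.1, arXiv:2308.02267).

## Rendering on the tree's real carriers (what a reviewer must accept), and faithfulness

The tree has no category of homological motives; it has Arapura's domination criterion ON THE REAL
CARRIERS, `HodgeTheory.IsDominatedByPowers dY Y dX B` ("every `Hᵏ(Y(ℂ); ℂ)` is the `ℂ`-span of the images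
of algebraic correspondences `Hᵃ(Bᵉ(ℂ); ℂ) → Hᵏ(Y(ℂ); ℂ)` from cartesian powers `Bᵉ`", file
`HodgeTheory/DominatedByPowersHodgeConjecture`, with its own faithfulness discussion).  The printed
conclusion "`h(X)` belongs to the thick tensor subcategory of homological motives generated by `h(KS(X))`",
with `⟨h(KS(X))⟩ = ⟨h(A)⟩` for the discriminant-1 Weil fourfold `A` (`KS(X) ~ A⁴`, proof of Cor. 13.4),
IMPLIES `IsDominatedByPowers (2 * n) X 4 A`: an object of `⟨h(A)⟩` is a direct summand of a finite sum
`⊕ᵢ h(A^{eᵢ})(mᵢ)` (`h(A)^∨ ≅ h(A)(4)`), and the components of a retraction `⊕ᵢ h(A^{eᵢ})(mᵢ) → h(X)` are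
algebraic correspondences (rational cycles modulo homological equivalence on `A^{eᵢ} × X`) whose images
span `H•(X, ℚ)`; rational cycle classes lie in the tree's `ℂ`-span of cycle classes.  The converse
(domination ⟹ membership in `⟨h(A)⟩` of HOMOLOGICAL motives) would need a splitting and is NOT claimed.
Hence the fact below is a CONSEQUENCE of the printed theorem (weaker-or-equal), never stronger:
* "any variety of `Kum²`-type ∕ `Kum³`-type": `n = 2 ∨ n = 3`, `Motives.IsSmoothProjective (2 * n) X`,
  `IsOfGeneralizedKummerType n X` — Floccari's standing convention "variety of `Kumⁿ`-type = projective
  hyper-Kähler manifold of `Kumⁿ`-type" (the rendering of every `Kumⁿ` record of this layer; irreducible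
  symplectic is a consequence, `Beauville1983_irreducibleSymplectic_of_kummerType`, not a clause).
* "an abelian fourfold of Weil type with discriminant `1`" (print: `A` = the intermediate Jacobian):
  EXACTLY the binder block of `Markman2023_thirdCohomology_kummerType_discOneWeilFourfold` ∕
  `FloccariFu2026_hodgeClasses_algebraic_powers_discOneWeilFourfold` — `T : Motives.AbelianVariety ℂ`,
  `T.dim = 2 * 2`, `φ ≫ φ = -(d • 𝟙 T)` with `0 < d`, a projective embedding `e` of `T.X`, a rational
  ambient class `a ≠ 0`, `Motives.IsHyperbolicWeilType T φ 2 (d·e^*a + φ^*e^*a)` (discriminant `1` ⟺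
  hyperbolic for fourfolds, dictionary of `Motives/HyperbolicWeilType`) — so that the two records compose
  with this one without transport.  That `T` may be taken to be (isogenous to) `J³(X)` with Markman's `γ` is
  provenance (the cited record), not re-asserted here.
* "motivated by" ⟶ `HodgeTheory.IsDominatedByPowers (2 * n) X 4 T.X` (above).
* NOT typed, with reasons: the clause "`KS(X)` is isogenous to a power of an abelian fourfold of Weil type"
  — on the tree's Kuga–Satake carriers (`Hyperkaehler.IsTranscendentalPartHK`, presentations of
  `(H²_tr(X), q)`, [Flo24] §5.1 convention) the literal sentence is dimensionally false for special members:
  `dim KS(H²_tr(X)) = 2^{rk H²_tr - 2} = 2^{5-ρ(X)}` is `2` or `1` for Picard rank `ρ(X) = 4, 5` (`b₂ = 7`),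
  not a multiple of `4`; it is O'Grady's `KS(X,L) = KS(c₁(L)^⊥)` (rank `6`, dimension `16 = 4·4`, every
  `(X,L)`) that is `~ J³(X)⁴` [O'Grady 2021 Thm. 1.5, tree: `OGrady2021_kugaSatake_kummerType_fourthPower_thirdCohomology`
  for the `ρ = 1` Hodge-structure form]; the motivic conclusion is insensitive to the convention and is what
  is typed.  Cor. 13.4 for PRODUCTS of Hodge-similar varieties and for the Kuga–Satake varieties (needs the
  common isogeny factor `A`); Cor. 13.6 (Frobenius-algebra isomorphism of motives), Rem. 13.5 (for `Kumⁿ`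
  already `Varesco2023_transcendentalHodgeMorphism_algebraic_kummerType`), Cor. 13.10 (Tate; no `k`-model
  carriers); items (i) and (iv) of Thm. 13.2 (K3^[n] ∕ OG6 sides have their own files and seats).

## Content

* NAMED FACT `FloccariFu2026_kum2Kum3Type_isDominatedByPowers_discOneWeilFourfold` (Thm. 13.2 (ii)(iii) in
  the domination form; PREPRINT) — +1 named fact (D-0026 accounting: a theorem with a printed proof in a
  2026 preprint, cited at the page; no restatement of any tree fact: the tree's records give `J³(X)` with
  `H³` and `H^{4n-2}` reached, not domination of ALL of `H•(X)`).
* Kernel, all PROVED (standard axioms): `nonempty_powSuccXIsoPow` (`(T^{(m+1)}).X ≅ T.X^{m+1}`),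
  `hodgeConjectureFor_pow_of_forall_powSucc` (HC for the `T.powSucc k` ⟹ HC for the cartesian powers
  `T.X.pow (m+1)` in dimension `(m+1)·dim T`); in the fact's namespace: `.kum2Type`, `.kum3Type` (spellings),
  `.exists_fourfold_powers` (the shape `∃ B, IsSmoothProjective 4 B ∧ (∀ m, HC (B^{m+1})) ∧ IsDominatedByPowers`
  of the `Kum⁴` cell's node and of the staged all-`n` statement, AS A THEOREM for `n = 2, 3` modulo this fact
  and the Floccari–Fu JMPA record), `.hodgeConjectureFor_powers` (= Cor. 13.4 "in particular": HC for `X`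
  and every power `X^{m+1}`, `n = 2, 3`, modulo the three records — the printed proof, composed),
  `.kum2Type_powers`, `.kum3Type_powers`, and the by-name consistency checks `.floccariVaresco2024_kum2Type`,
  `.floccari2023_kum3Type` (the power `m = 0` recovers the statements of the two single-variety records).
-/

noncomputable section

open CategoryTheory MonoidalCategory

namespace Literature.AlgebraicGeometry.HodgeTheory

open Motives (SchemeOver IsSmoothProjective AbelianVariety)

/-! ### Bookkeeping: the abelian-variety power `T^{(m+1)}` versus the cartesian power `T.X^{m+1}` -/

/-- `(T.powSucc m).X ≅ T.X.pow (m + 1)`: both are iterated binary products bracketed on the left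
(`AbelianVariety.powSucc`: `T`, `T × T`, …, with `(A.prod B).X = A.X ⊗ B.X`; `SchemeOver.pow`: `𝟙 ⊗ T.X`,
`(𝟙 ⊗ T.X) ⊗ T.X`, …); base case the left unitor `powOneIso`.  Bookkeeping of iterated fibre products
(associativity/unit up to canonical isomorphism). [cite: Hartshorne1977, II §3 (products of schemes; Thm. 3.3 and the canonical isomorphisms)]
[cite: LangeBirkenhake1992, Thm. 4.2.1 (products of abelian varieties)] -/
theorem nonempty_powSuccXIsoPow (T : AbelianVariety ℂ) :
    ∀ m : ℕ, Nonempty ((T.powSucc m).X ≅ T.X.pow (m + 1))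
  | 0 => ⟨(powOneIso T.X).symm⟩
  | m + 1 => (nonempty_powSuccXIsoPow T m).elim fun i ↦ ⟨whiskerRightIso i T.X⟩

/-- `dim T^{(m+1)} = (m + 1) · dim T` (restated next to the bridge; the tree proves the same line as
`HodgeTheory.dim_powSucc` in a heavier module). [cite: LangeBirkenhake1992, Thm. 4.2.1] -/
theorem dim_powSucc_eq_succ_mul (T : AbelianVariety ℂ) : ∀ m : ℕ, (T.powSucc m).dim = (m + 1) * T.dim
  | 0 => by rw [Motives.AbelianVariety.powSucc_zero, zero_add, one_mul]
  | m + 1 => by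
    rw [Motives.AbelianVariety.powSucc_succ, Motives.AbelianVariety.dim_prod, dim_powSucc_eq_succ_mul T m]
    ring

/-- The per-variety Hodge statement for every abelian-variety power `T.powSucc k` (in its dimension) gives
the per-variety Hodge statement for every cartesian power `T.X.pow (m + 1)` in dimension `(m + 1) · dim T`
— the shape in which `IsDominatedByPowers` ∕ Arapura's Lemma 4.2 consume "all powers" (transport along
`nonempty_powSuccXIsoPow`, `hodgeConjectureFor_iff_of_iso'`). [cite: Arapura2006, Lemma 4.2 (the "all its powers" clause)] -/
theorem hodgeConjectureFor_pow_of_forall_powSucc (T : AbelianVariety ℂ)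
    (h : ∀ k : ℕ, HodgeConjectureFor (T.powSucc k).dim (T.powSucc k).X) (m : ℕ) :
    HodgeConjectureFor ((m + 1) * T.dim) (T.X.pow (m + 1)) := by
  obtain ⟨i⟩ := nonempty_powSuccXIsoPow T m
  rw [← dim_powSucc_eq_succ_mul T m]
  exact (hodgeConjectureFor_iff_of_iso' i).1 (h m)

end Literature.AlgebraicGeometry.HodgeTheory

namespace Literature.AlgebraicGeometry.Hyperkaehler

open HodgeTheory
open Motives (SchemeOver IsSmoothProjective AbelianVariety)

/-! ### The named fact (D-0014): Floccari–Fu 2026 Thm. 13.2 (ii)(iii), domination form -/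

/-- **Floccari–Fu 2026 (*The hyper-Kummer construction*), Thm. 13.2 (ii)(iii) = Thm. K (ii) — PREPRINT:
every projective variety of `Kum²`- or `Kum³`-type is motivated, in homological motives, by a
discriminant-1 abelian fourfold of Weil type (its intermediate Jacobian `A`, with `KS(X) ~ A⁴`)** — printed:
"any variety of `Kum²`-type; any variety of `Kum³`-type […] `h(X)` belongs to the thick tensor subcategory
of homological motives generated by the motive of `KS(X)`", and (proof of Cor. 13.4) "the tensor
subcategories `⟨h(KS(X_i))⟩` […] all coincide with `⟨h(A)⟩`", `A` "of Weil type with discriminant `1`"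
(verbatim in the module docstring).  Rendering (module docstring): for `n = 2` or `n = 3` and `X` smooth
projective of dimension `2n` of `Kumⁿ`-type, there is a datum `(d, T, φ, e, a)` — an abelian FOURFOLD `T`
with `φ ≫ φ = -d`, `0 < d`, and `IsHyperbolicWeilType T φ 2 (d·e^*a + φ^*e^*a)` for a rational hyperplane
class (the binder block of `Markman2023_thirdCohomology_kummerType_discOneWeilFourfold` and of
`FloccariFu2026_hodgeClasses_algebraic_powers_discOneWeilFourfold`, symbol for symbol) — such that `X` is
cohomologically DOMINATED BY THE POWERS of `T.X` (`HodgeTheory.IsDominatedByPowers (2 * n) X 4 T.X`: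
every `Hᵏ(X(ℂ); ℂ)` is spanned by images of algebraic correspondences from cartesian powers of `T`), a
consequence of the printed motivic statement (weaker-or-equal; the converse is not claimed).  Status:
PREPRINT theorem (arXiv:2607.07528, July 2026, not refereed; its proof composes [FV24], [Fos24], [HT13],
[O'G21, Mar22, Voi22] for `n = 2` and [Flo23] = arXiv:2308.02267 + the hyper-Kummer construction [Flo24]
for `n = 3`); no statement for `n ≥ 4`.  Unproved in the tree; an explicit hypothesis wherever used.
[cite: FloccariFu2026HyperKummer, Thm. 13.2 (ii)(iii) (arXiv:2607.07528 p. 86 L14–L24; proof pp. 86–87) and proof of Cor. 13.4 (p. 88 L13–L26); = Thm. K (ii) (pp. 13–14); PREPRINT]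
[cite: Arapura2006, §1 Lemma 1.1 (motivated ⟺ surjection from ⊕ [A]^{⊗e}(m) on cohomology)]
[cite: OGrady2021KummerTori, Thm. 1.5 (the intermediate Jacobian; KS(X,L) ~ J³(X)⁴)] -/
def FloccariFu2026_kum2Kum3Type_isDominatedByPowers_discOneWeilFourfold : Prop :=
  ∀ (n : ℕ), n = 2 ∨ n = 3 → ∀ ⦃X : SchemeOver ℂ⦄, IsSmoothProjective (2 * n) X →
    IsOfGeneralizedKummerType n X →
      ∃ (d : ℕ) (T : AbelianVariety ℂ) (φ : T ⟶ T) (e : Motives.ProjectiveEmbedding T.X)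
        (a : complexBetti (Motives.projectiveSpace e.n ℂ) 2),
        0 < d ∧ T.dim = 2 * 2 ∧ φ ≫ φ = -(d • 𝟙 T) ∧ IsRationalClass a ∧ a ≠ 0 ∧
          Motives.IsHyperbolicWeilType T φ 2
            ((d : ℂ) • complexBetti.map e.ι 2 a +
              complexBetti.map φ.hom.hom.hom 2 (complexBetti.map e.ι 2 a)) ∧
          IsDominatedByPowers (2 * n) X 4 T.X

namespace FloccariFu2026_kum2Kum3Type_isDominatedByPowers_discOneWeilFourfold

/-- The `Kum²`-type spelling (dimension `4`): Thm. 13.2 (ii). [cite: FloccariFu2026HyperKummer, Thm. 13.2 (ii) (p. 86); PREPRINT] -/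
theorem kum2Type (h : FloccariFu2026_kum2Kum3Type_isDominatedByPowers_discOneWeilFourfold)
    {X : SchemeOver ℂ} (hX : IsSmoothProjective 4 X) (hK : IsOfGeneralizedKummerType 2 X) :
    ∃ (d : ℕ) (T : AbelianVariety ℂ) (φ : T ⟶ T) (e : Motives.ProjectiveEmbedding T.X)
      (a : complexBetti (Motives.projectiveSpace e.n ℂ) 2),
      0 < d ∧ T.dim = 2 * 2 ∧ φ ≫ φ = -(d • 𝟙 T) ∧ IsRationalClass a ∧ a ≠ 0 ∧
        Motives.IsHyperbolicWeilType T φ 2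
          ((d : ℂ) • complexBetti.map e.ι 2 a +
            complexBetti.map φ.hom.hom.hom 2 (complexBetti.map e.ι 2 a)) ∧
        IsDominatedByPowers 4 X 4 T.X :=
  h 2 (Or.inl rfl) hX hK

/-- The `Kum³`-type spelling (dimension `6`): Thm. 13.2 (iii). [cite: FloccariFu2026HyperKummer, Thm. 13.2 (iii) (p. 86, proof p. 87); PREPRINT] -/
theorem kum3Type (h : FloccariFu2026_kum2Kum3Type_isDominatedByPowers_discOneWeilFourfold)
    {X : SchemeOver ℂ} (hX : IsSmoothProjective 6 X) (hK : IsOfGeneralizedKummerType 3 X) :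
    ∃ (d : ℕ) (T : AbelianVariety ℂ) (φ : T ⟶ T) (e : Motives.ProjectiveEmbedding T.X)
      (a : complexBetti (Motives.projectiveSpace e.n ℂ) 2),
      0 < d ∧ T.dim = 2 * 2 ∧ φ ≫ φ = -(d • 𝟙 T) ∧ IsRationalClass a ∧ a ≠ 0 ∧
        Motives.IsHyperbolicWeilType T φ 2
          ((d : ℂ) • complexBetti.map e.ι 2 a +
            complexBetti.map φ.hom.hom.hom 2 (complexBetti.map e.ι 2 a)) ∧
        IsDominatedByPowers 6 X 4 T.X :=
  h 3 (Or.inr rfl) hX hK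

/-- **With the Floccari–Fu JMPA record (HC for all powers of a discriminant-1 Weil fourfold): every
projective `Kum²`/`Kum³`-type `X` is dominated by the powers of a smooth projective FOURFOLD `B` all of whose
cartesian powers satisfy the per-variety Hodge statement** — the `n = 2, 3` instance, AS A THEOREM modulo the
two records, of the shape `∃ B, IsSmoothProjective 4 B ∧ (∀ m, HodgeConjectureFor ((m+1)·4) (B^{m+1})) ∧
IsDominatedByPowers (2n) X 4 B` (the conclusion of the `Kum⁴` cell's `exists_isDominatedByPowers_kum4Type`,
there CONDITIONAL at `n = 4`).  Printed provenance: proof of Cor. 13.4 ("`R : ⟨h(A)⟩ → HS_ℚ` is full",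
[Mar22], [Flo26], [FF26]). [cite: FloccariFu2026HyperKummer, Thm. 13.2 (ii)(iii) and proof of Cor. 13.4 (p. 88); PREPRINT]
[cite: FloccariFu2026, Thm. 1.2 (HC for all powers of a discriminant-1 Weil fourfold)] -/
theorem exists_fourfold_powers (h : FloccariFu2026_kum2Kum3Type_isDominatedByPowers_discOneWeilFourfold)
    (hFF : FloccariFu2026_hodgeClasses_algebraic_powers_discOneWeilFourfold)
    {n : ℕ} (hn : n = 2 ∨ n = 3) {X : SchemeOver ℂ} (hX : IsSmoothProjective (2 * n) X)
    (hK : IsOfGeneralizedKummerType n X) :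
    ∃ B : SchemeOver ℂ, IsSmoothProjective 4 B ∧
      (∀ m : ℕ, HodgeConjectureFor ((m + 1) * 4) (B.pow (m + 1))) ∧ IsDominatedByPowers (2 * n) X 4 B := by
  obtain ⟨d, T, φ, e, a, hd, hT, hφ, ha, ha0, hyp, hdom⟩ := h n hn hX hK
  have hB : IsSmoothProjective 4 T.X := by
    have hB' : IsSmoothProjective T.dim T.X := Motives.AbelianVariety.isSmoothProjective_holds
    rwa [hT] at hB'
  refine ⟨T.X, hB, fun m ↦ ?_, hdom⟩
  simpa [hT] using hodgeConjectureFor_pow_of_forall_powSucc T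
    (hodgeConjectureFor_powSucc_of_floccariFu hFF hd T φ hT hφ e a ha ha0 hyp) m

/-- **Floccari–Fu 2026, Cor. 13.4 ("In particular, the Hodge conjecture holds for all powers of any
hyper-Kähler variety `X` as in Theorem 13.2"), items (ii)(iii) — AS A KERNEL THEOREM modulo three records:**
for `n = 2, 3` and `X` smooth projective of `Kumⁿ`-type, the per-variety Hodge statement for `X` and for
every cartesian power `X^{m+1}` follows from this file's fact, the Floccari–Fu JMPA record (powers of
disc-1 Weil fourfolds) and Arapura 2006 Lemma 4.2 (`Arapura2006_hodgeClasses_algebraic_of_isDominatedByPowers`)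
— which is the printed proof, composed.  PREPRINT (the first record). [cite: FloccariFu2026HyperKummer, Cor. 13.4 (p. 88 L9–L26) = Thm. K (ii) "Moreover" (p. 14 L5–L9); PREPRINT]
[cite: Arapura2006, Lemma 4.2] [cite: FloccariFu2026, Thm. 1.2] -/
theorem hodgeConjectureFor_powers (h : FloccariFu2026_kum2Kum3Type_isDominatedByPowers_discOneWeilFourfold)
    (hFF : FloccariFu2026_hodgeClasses_algebraic_powers_discOneWeilFourfold)
    (h42 : Arapura2006_hodgeClasses_algebraic_of_isDominatedByPowers)
    {n : ℕ} (hn : n = 2 ∨ n = 3) {X : SchemeOver ℂ} (hX : IsSmoothProjective (2 * n) X)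
    (hK : IsOfGeneralizedKummerType n X) :
    HodgeConjectureFor (2 * n) X ∧ ∀ m : ℕ, HodgeConjectureFor ((m + 1) * (2 * n)) (X.pow (m + 1)) := by
  obtain ⟨B, hB, hpow, hdom⟩ := exists_fourfold_powers h hFF hn hX hK
  exact h42 hB hX hdom hpow

/-- Cor. 13.4 for `Kum²`-type, spelled in dimension `4`: the per-variety Hodge statement for `X` and all
powers `X^{m+1}` (dimension `(m+1)·4`). [cite: FloccariFu2026HyperKummer, Cor. 13.4 with Thm. 13.2 (ii); PREPRINT] -/
theorem kum2Type_powers (h : FloccariFu2026_kum2Kum3Type_isDominatedByPowers_discOneWeilFourfold)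
    (hFF : FloccariFu2026_hodgeClasses_algebraic_powers_discOneWeilFourfold)
    (h42 : Arapura2006_hodgeClasses_algebraic_of_isDominatedByPowers)
    {X : SchemeOver ℂ} (hX : IsSmoothProjective 4 X) (hK : IsOfGeneralizedKummerType 2 X) :
    HodgeConjectureFor 4 X ∧ ∀ m : ℕ, HodgeConjectureFor ((m + 1) * 4) (X.pow (m + 1)) :=
  hodgeConjectureFor_powers h hFF h42 (n := 2) (Or.inl rfl) hX hK

/-- Cor. 13.4 for `Kum³`-type, spelled in dimension `6`: the per-variety Hodge statement for `X` and all
powers `X^{m+1}` (dimension `(m+1)·6`). [cite: FloccariFu2026HyperKummer, Cor. 13.4 with Thm. 13.2 (iii); PREPRINT] -/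
theorem kum3Type_powers (h : FloccariFu2026_kum2Kum3Type_isDominatedByPowers_discOneWeilFourfold)
    (hFF : FloccariFu2026_hodgeClasses_algebraic_powers_discOneWeilFourfold)
    (h42 : Arapura2006_hodgeClasses_algebraic_of_isDominatedByPowers)
    {X : SchemeOver ℂ} (hX : IsSmoothProjective 6 X) (hK : IsOfGeneralizedKummerType 3 X) :
    HodgeConjectureFor 6 X ∧ ∀ m : ℕ, HodgeConjectureFor ((m + 1) * 6) (X.pow (m + 1)) :=
  hodgeConjectureFor_powers h hFF h42 (n := 3) (Or.inr rfl) hX hK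

/-- Consistency BY NAME: the power `m = 0` of Cor. 13.4 (ii) is the STATEMENT of the tree's record of
Floccari–Varesco 2024 Cor. 1.2 (`FloccariVaresco2024_hodgeClasses_algebraic_kum2Type`, REFEREED) — the three
records imply it. [cite: FloccariVaresco2024, Cor. 1.2 (§1)] [cite: FloccariFu2026HyperKummer, Cor. 13.4; PREPRINT] -/
theorem floccariVaresco2024_kum2Type (h : FloccariFu2026_kum2Kum3Type_isDominatedByPowers_discOneWeilFourfold)
    (hFF : FloccariFu2026_hodgeClasses_algebraic_powers_discOneWeilFourfold)
    (h42 : Arapura2006_hodgeClasses_algebraic_of_isDominatedByPowers) :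
    FloccariVaresco2024_hodgeClasses_algebraic_kum2Type :=
  fun _ hX hK ↦ (kum2Type_powers h hFF h42 hX hK).1

/-- Consistency BY NAME: the power `m = 0` of Cor. 13.4 (iii) is the STATEMENT of the tree's record of
Floccari 2023 Thm. 1.1 (`Floccari2023_hodgeClasses_algebraic_kum3Type`, arXiv:2308.02267) — the three
records imply it (in print the dependence runs the other way: Thm. 13.2 (iii) rests on [Flo23]).
[cite: Floccari2023, Thm. 1.1 (§1)] [cite: FloccariFu2026HyperKummer, Thm. 13.2 (iii) proof (p. 87) and Cor. 13.4; PREPRINT] -/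
theorem floccari2023_kum3Type (h : FloccariFu2026_kum2Kum3Type_isDominatedByPowers_discOneWeilFourfold)
    (hFF : FloccariFu2026_hodgeClasses_algebraic_powers_discOneWeilFourfold)
    (h42 : Arapura2006_hodgeClasses_algebraic_of_isDominatedByPowers) :
    Floccari2023_hodgeClasses_algebraic_kum3Type :=
  fun _ hX hK ↦ (kum3Type_powers h hFF h42 hX hK).1

end FloccariFu2026_kum2Kum3Type_isDominatedByPowers_discOneWeilFourfold

end Literature.AlgebraicGeometry.Hyperkaehler

end
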